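import Summits.CriticalPhenomena.PercolationContinuityZ3.Theorems.PercNearOneGluingNoHeavyQuantCombLevels
import Mathlib.Topology.UnitInterval
import Mathlib.Algebra.BigOperators.Group.Finset.Basic
import HarnessLib

/-!
# QUANT lane R8 — splicing a hair INTO the spine of a comb: the comb shape survives (combinatorics of the SPLICE endpoint)

builds on p205010 (kernel theorem, internal audit signed; external expert review pending)

Support file (`--supports stmt-CriticalPhenomena-4575`), QUANT lane lead (gen 9), rung R8 of `run/shared/lean/prim/quant/LADDER.md`;
memo `prim-quant-lead-g9/LEAD-NOTES-G9.md` N20 step (4) — seventh file of the kernel proof of FAR (`Quant.FarTreeRow`) at EVERY layer on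
COMBS.  Setting of `…QuantCombLevels.lean`.  THE SPLICE: a hair `b` (level `≤ m`) becomes a new spine gate right below level `m`, i.e.
between `S m` and the gate `s` of rank `m+1`:  `P' b = S m ∪ {b}`, every prefix containing `s` gains `b`, all other prefixes are unchanged;
the gates are rescaled at `b` and `s` only, with `q' s · q' b = q s` and `q' b · π_m = T_b` (so that every marginal is unchanged).
Pure combinatorics plus the product bookkeeping; no probability.  Theorems only; no sorries; standard axioms.

* `Quant.comb_splice_spine` — the new spine `P' a = P a ∪ {b}` is again an unglued chain with down-closed prefixes.
* `Quant.comb_splice_relays` — spine parts of relays stay down-closed, private parts are unchanged (that of `b` becomes empty), tips stay.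
* `Quant.comb_splice_marginal` — `∏_{P' z} q' = ∏_{P z} q` for every relay and for the spine.
* `Quant.comb_splice_measure` — the set of hairs attached at a positive level loses exactly `b`.
[this work]
-/

noncomputable section

namespace Summit.CriticalPhenomena.PercolationContinuityZ3.Theorems

namespace Quant

open Finset
open scoped Classical

variable {ι : Type*}

/-- For a spine gate `y`: `s ∈ P y` iff `y` lies strictly below level `m`. [this work] -/
theorem comb_splice_mem_spine_iff (P : ι → Finset ι) (a : ι)
    (hsp : ∀ y ∈ P a, y ∈ P y ∧ P y ⊆ P a ∧ ∀ y' ∈ P a,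
      (y ∈ P y' ∨ y' ∈ P y) ∧ (y ∈ P y' → P y ⊆ P y') ∧ (y ∈ P y' → y' ∈ P y → y = y')) {s : ι} {m : ℕ} (hs : s ∈ P a) (hsm : (P s).card = m + 1)
    {y : ι} (hy : y ∈ P a) : s ∈ P y ↔ ¬ (P y).card ≤ m := by
  rw [comb_spine_mem_iff_card_le P a hsp hs hy, hsm]; omega

/-- The new spine is `P a ∪ {b}`. [this work] -/
theorem comb_splice_spine_eq (P P' : ι → Finset ι) (a : ι) {b s : ι} (hba : b ∉ P a) (hbb : b ∈ P b) (hs : s ∈ P a)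
    (hP'1 : ∀ x, x ≠ b → s ∈ P x → P' x = insert b (P x)) : P' a = insert b (P a) :=
  hP'1 a (fun h => hba (by rw [h]; exact hbb)) hs

/-- `S m ⊆ P s` and `S m ⊆ P a`, and `s, b ∉ S m`. [this work] -/
theorem comb_splice_Sm_facts (P : ι → Finset ι) (a : ι)
    (hsp : ∀ y ∈ P a, y ∈ P y ∧ P y ⊆ P a ∧ ∀ y' ∈ P a,
      (y ∈ P y' ∨ y' ∈ P y) ∧ (y ∈ P y' → P y ⊆ P y') ∧ (y ∈ P y' → y' ∈ P y → y = y')) {b s : ι} {m : ℕ} (hba : b ∉ P a) (hs : s ∈ P a) (hsm : (P s).card = m + 1) :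
    (P a).filter (fun y => (P y).card ≤ m) ⊆ P s ∧ s ∉ (P a).filter (fun y => (P y).card ≤ m) ∧
      b ∉ (P a).filter (fun y => (P y).card ≤ m) := by
  refine ⟨?_, fun h => by have := (Finset.mem_filter.1 h).2; omega, fun h => hba (Finset.mem_filter.1 h).1⟩
  rw [comb_spine_prefix_eq_level P a hsp hs, hsm]
  exact comb_level_mono P a (Nat.le_succ m)

/-- **The spliced spine is an unglued chain with down-closed prefixes.** [this work] -/
theorem comb_splice_spine (P P' : ι → Finset ι) (a : ι) {b s : ι} {m : ℕ}
    (hsp : ∀ y ∈ P a, y ∈ P y ∧ P y ⊆ P a ∧ ∀ y' ∈ P a,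
      (y ∈ P y' ∨ y' ∈ P y) ∧ (y ∈ P y' → P y ⊆ P y') ∧ (y ∈ P y' → y' ∈ P y → y = y'))
    (hba : b ∉ P a) (hbb : b ∈ P b) (hs : s ∈ P a) (hsm : (P s).card = m + 1)
    (hP'b : P' b = insert b ((P a).filter fun y => (P y).card ≤ m))
    (hP'1 : ∀ x, x ≠ b → s ∈ P x → P' x = insert b (P x)) (hP'2 : ∀ x, x ≠ b → s ∉ P x → P' x = P x) :
    ∀ y ∈ P' a, y ∈ P' y ∧ P' y ⊆ P' a ∧ ∀ y' ∈ P' a,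
      (y ∈ P' y' ∨ y' ∈ P' y) ∧ (y ∈ P' y' → P' y ⊆ P' y') ∧ (y ∈ P' y' → y' ∈ P' y → y = y') := by
  have hPa : P' a = insert b (P a) := comb_splice_spine_eq P P' a hba hbb hs hP'1
  obtain ⟨hSm_s, -, -⟩ := comb_splice_Sm_facts P a hsp hba hs hsm (b := b)
  have hmem : ∀ {y : ι}, y ∈ P a → (s ∈ P y ↔ ¬ (P y).card ≤ m) := fun hy =>
    comb_splice_mem_spine_iff P a hsp hs hsm hy
  -- the new prefix of an old spine gate, in the two cases
  have hdeep : ∀ {y : ι}, y ∈ P a → s ∈ P y → P' y = insert b (P y) := fun hy hsy =>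
    hP'1 _ (fun h => hba (h ▸ hy)) hsy
  have hshal : ∀ {y : ι}, y ∈ P a → s ∉ P y → P' y = P y ∧ y ∈ (P a).filter (fun y => (P y).card ≤ m) :=
    fun hy hsy => ⟨hP'2 _ (fun h => hba (h ▸ hy)) hsy, Finset.mem_filter.2 ⟨hy, not_not.1 fun h => hsy ((hmem hy).2 h)⟩⟩
  have hshal_sub : ∀ {y : ι}, y ∈ P a → s ∉ P y → P y ⊆ (P a).filter (fun y => (P y).card ≤ m) := by
    intro y hy hsy
    rw [comb_spine_prefix_eq_level P a hsp hy]
    exact comb_level_mono P a (not_not.1 fun h => hsy ((hmem hy).2 h))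
  rw [hPa]
  intro y hy
  rw [Finset.mem_insert] at hy
  rcases hy with rfl | hy
  · -- the new gate `b`
    refine ⟨by rw [hP'b]; exact Finset.mem_insert_self _ _,
      by rw [hP'b]; exact Finset.insert_subset_insert _ (Finset.filter_subset _ _), fun y' hy' => ?_⟩
    rw [Finset.mem_insert] at hy'
    rcases hy' with rfl | hy'
    · refine ⟨Or.inl (by rw [hP'b]; exact Finset.mem_insert_self _ _), fun _ => le_rfl, fun _ _ => rfl⟩
    · by_cases hsy' : s ∈ P y'
      · rw [hdeep hy' hsy']
        refine ⟨Or.inl (Finset.mem_insert_self _ _), fun _ => ?_, fun _ h => ?_⟩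
        · rw [hP'b]
          exact Finset.insert_subset_insert _ (hSm_s.trans ((hsp s hs).2.2 y' hy' |>.2.1 hsy'))
        · rw [hP'b, Finset.mem_insert] at h
          rcases h with h | h
          · exact h.symm
          · exact absurd (Finset.mem_filter.1 h).2 ((hmem hy').1 hsy')
      · obtain ⟨hP'y', hy'Sm⟩ := hshal hy' hsy'
        rw [hP'y']
        refine ⟨Or.inr (by rw [hP'b]; exact Finset.mem_insert_of_mem hy'Sm), fun h => absurd h ?_, fun h => absurd h ?_⟩
        · exact fun h' => hba ((hsp y' hy').2.1 h')
        · exact fun h' => hba ((hsp y' hy').2.1 h')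
  · -- an old spine gate `y`
    obtain ⟨hyy, hyPa, hrel⟩ := hsp y hy
    have hyb : y ≠ b := fun h => hba (h ▸ hy)
    refine ⟨?_, ?_, fun y' hy' => ?_⟩
    · by_cases hsy : s ∈ P y
      · rw [hdeep hy hsy]; exact Finset.mem_insert_of_mem hyy
      · rw [(hshal hy hsy).1]; exact hyy
    · by_cases hsy : s ∈ P y
      · rw [hdeep hy hsy]; exact Finset.insert_subset_insert _ hyPa
      · rw [(hshal hy hsy).1]; exact hyPa.trans (Finset.subset_insert _ _)
    rw [Finset.mem_insert] at hy'
    rcases hy' with rfl | hy'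
    · -- compare with the new gate
      refine ⟨?_, fun h => ?_, fun h h' => ?_⟩
      · by_cases hsy : s ∈ P y
        · right; rw [hdeep hy hsy]; exact Finset.mem_insert_self _ _
        · left; rw [hP'b]; exact Finset.mem_insert_of_mem (hshal hy hsy).2
      · rw [hP'b, Finset.mem_insert] at h
        rcases h with h | h
        · exact absurd h hyb
        · have hsy : s ∉ P y := fun hs' => (hmem hy).1 hs' (Finset.mem_filter.1 h).2
          rw [(hshal hy hsy).1, hP'b]
          exact (hshal_sub hy hsy).trans (Finset.subset_insert _ _)
      · rw [hP'b, Finset.mem_insert] at h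
        rcases h with h | h
        · exact h
        · exfalso
          have hcard := (Finset.mem_filter.1 h).2
          by_cases hsy : s ∈ P y
          · exact (hmem hy).1 hsy hcard
          · rw [(hshal hy hsy).1] at h'; exact hba (hyPa h')
    · -- compare with another old gate
      obtain ⟨hc, hsub, hanti⟩ := hrel y' hy'
      have hy'b : y' ≠ b := fun h => hba (h ▸ hy')
      have hmemb : ∀ {z w : ι}, z ∈ P a → w ≠ b → (w ∈ P' z ↔ w ∈ P z) := by
        intro z w hz hwb
        by_cases hsz : s ∈ P z
        · rw [hdeep hz hsz, Finset.mem_insert, or_iff_right hwb]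
        · rw [(hshal hz hsz).1]
      refine ⟨?_, fun h => ?_, fun h h' => ?_⟩
      · rcases hc with h | h
        · exact Or.inl ((hmemb hy' hyb).2 h)
        · exact Or.inr ((hmemb hy hy'b).2 h)
      · have h0 : y ∈ P y' := (hmemb hy' hyb).1 h
        have hPP : P y ⊆ P y' := hsub h0
        by_cases hsy : s ∈ P y
        · rw [hdeep hy hsy, hdeep hy' (hPP hsy)]; exact Finset.insert_subset_insert _ hPP
        · rw [(hshal hy hsy).1]
          by_cases hsy' : s ∈ P y'
          · rw [hdeep hy' hsy']; exact hPP.trans (Finset.subset_insert _ _)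
          · rw [(hshal hy' hsy').1]; exact hPP
      · exact hanti ((hmemb hy' hyb).1 h) ((hmemb hy hy'b).1 h')



/-- **Relays after the splice**: spine parts stay down-closed, private parts are unchanged off `b` (that of `b` is empty), tips stay.
[this work] -/
theorem comb_splice_relays (P P' : ι → Finset ι) (a : ι) (A : Finset ι) {b s : ι} {m : ℕ}
    (hsp : ∀ y ∈ P a, y ∈ P y ∧ P y ⊆ P a ∧ ∀ y' ∈ P a,
      (y ∈ P y' ∨ y' ∈ P y) ∧ (y ∈ P y' → P y ⊆ P y') ∧ (y ∈ P y' → y' ∈ P y → y = y'))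
    (hA5 : ∀ z ∈ A, ∀ y ∈ P z, y ∈ P a → P y ⊆ P z)
    (hA6 : ∀ z ∈ A, ∀ z' ∈ A, z ≠ z' → Disjoint (P z \ P a) (P z' \ P a))
    (hA8 : ∀ z ∈ A, z ∈ P z)
    (hbA : b ∈ A) (hba : b ∉ P a) (hs : s ∈ P a) (hsm : (P s).card = m + 1)
    (hP'b : P' b = insert b ((P a).filter fun y => (P y).card ≤ m))
    (hP'1 : ∀ x, x ≠ b → s ∈ P x → P' x = insert b (P x)) (hP'2 : ∀ x, x ≠ b → s ∉ P x → P' x = P x) :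
    (∀ z ∈ A, z ≠ b → P' z \ P' a = P z \ P a) ∧ P' b \ P' a = ∅ ∧
    (∀ z ∈ A, ∀ y ∈ P' z, y ∈ P' a → P' y ⊆ P' z) ∧
    (∀ z ∈ A, ∀ z' ∈ A, z ≠ z' → Disjoint (P' z \ P' a) (P' z' \ P' a)) ∧
    (∀ z ∈ A, z ∈ P' z) := by
  have hbb : b ∈ P b := hA8 b hbA
  have hPa : P' a = insert b (P a) := comb_splice_spine_eq P P' a hba hbb hs hP'1
  obtain ⟨hSm_s, -, -⟩ := comb_splice_Sm_facts P a hsp hba hs hsm (b := b)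
  have hmem : ∀ {y : ι}, y ∈ P a → (s ∈ P y ↔ ¬ (P y).card ≤ m) := fun hy =>
    comb_splice_mem_spine_iff P a hsp hs hsm hy
  have hbz : ∀ {z : ι}, z ∈ A → z ≠ b → b ∉ P z := by
    intro z hz hzb h
    exact Finset.disjoint_left.1 (hA6 z hz b hbA hzb) (Finset.mem_sdiff.2 ⟨h, hba⟩) (Finset.mem_sdiff.2 ⟨hbb, hba⟩)
  have hQ : ∀ z ∈ A, z ≠ b → P' z \ P' a = P z \ P a := by
    intro z hz hzb
    rw [hPa]
    by_cases hsz : s ∈ P z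
    · rw [hP'1 z hzb hsz, Finset.insert_sdiff_insert]
      ext y; simp only [Finset.mem_sdiff, Finset.mem_insert, not_or]
      constructor
      · rintro ⟨h1, -, h2⟩; exact ⟨h1, h2⟩
      · rintro ⟨h1, h2⟩; exact ⟨h1, fun h => hbz hz hzb (h ▸ h1), h2⟩
    · rw [hP'2 z hzb hsz]
      ext y; simp only [Finset.mem_sdiff, Finset.mem_insert, not_or]
      constructor
      · rintro ⟨h1, -, h2⟩; exact ⟨h1, h2⟩
      · rintro ⟨h1, h2⟩; exact ⟨h1, fun h => hbz hz hzb (h ▸ h1), h2⟩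
  have hQb : P' b \ P' a = ∅ := by
    rw [hP'b, hPa, Finset.insert_sdiff_insert, Finset.sdiff_eq_empty_iff_subset]
    exact (Finset.filter_subset _ _).trans (Finset.subset_insert _ _)
  refine ⟨hQ, hQb, ?_, ?_, ?_⟩
  · intro z hz y hy hya
    rw [hPa, Finset.mem_insert] at hya
    by_cases hzb : z = b
    · subst hzb
      rw [hP'b] at hy ⊢
      rcases hya with rfl | hya
      · rw [hP'b]
      · have hyb : y ≠ z := fun h => hba (h ▸ hya)
        rw [Finset.mem_insert, or_iff_right hyb] at hy
        have hcard := (Finset.mem_filter.1 hy).2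
        have hsy : s ∉ P y := fun h => (hmem hya).1 h hcard
        rw [hP'2 y hyb hsy, comb_spine_prefix_eq_level P a hsp hya]
        exact (comb_level_mono P a hcard).trans (Finset.subset_insert _ _)
    · rcases hya with rfl | hya
      · -- `y = b ∈ P' z` forces `s ∈ P z`
        by_cases hsz : s ∈ P z
        · rw [hP'1 z hzb hsz, hP'b]
          exact Finset.insert_subset_insert _ (hSm_s.trans (hA5 z hz s hsz hs))
        · rw [hP'2 z hzb hsz] at hy; exact absurd hy (hbz hz hzb)
      · have hyb : y ≠ b := fun h => hba (h ▸ hya)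
        have hyz : y ∈ P z := by
          by_cases hsz : s ∈ P z
          · rw [hP'1 z hzb hsz, Finset.mem_insert, or_iff_right hyb] at hy; exact hy
          · rw [hP'2 z hzb hsz] at hy; exact hy
        have hPyz : P y ⊆ P z := hA5 z hz y hyz hya
        by_cases hsy : s ∈ P y
        · rw [hP'1 y hyb hsy, hP'1 z hzb (hPyz hsy)]; exact Finset.insert_subset_insert _ hPyz
        · rw [hP'2 y hyb hsy]
          by_cases hsz : s ∈ P z
          · rw [hP'1 z hzb hsz]; exact hPyz.trans (Finset.subset_insert _ _)
          · rw [hP'2 z hzb hsz]; exact hPyz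
  · intro z hz z' hz' hne
    by_cases hzb : z = b
    · subst hzb; rw [hQb]; exact Finset.disjoint_empty_left _
    by_cases hz'b : z' = b
    · subst hz'b; rw [hQb]; exact Finset.disjoint_empty_right _
    rw [hQ z hz hzb, hQ z' hz' hz'b]; exact hA6 z hz z' hz' hne
  · intro z hz
    by_cases hzb : z = b
    · subst hzb; rw [hP'b]; exact Finset.mem_insert_self _ _
    · by_cases hsz : s ∈ P z
      · rw [hP'1 z hzb hsz]; exact Finset.mem_insert_of_mem (hA8 z hz)
      · rw [hP'2 z hzb hsz]; exact hA8 z hz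

/-- **Marginals after the splice are unchanged**, and the new spine has the old least marginal. [this work] -/
theorem comb_splice_marginal (q q' : ι → unitInterval) (P P' : ι → Finset ι) (a : ι) (A : Finset ι) {b s : ι} {m : ℕ}
    (hsp : ∀ y ∈ P a, y ∈ P y ∧ P y ⊆ P a ∧ ∀ y' ∈ P a,
      (y ∈ P y' ∨ y' ∈ P y) ∧ (y ∈ P y' → P y ⊆ P y') ∧ (y ∈ P y' → y' ∈ P y → y = y'))
    (hA6 : ∀ z ∈ A, ∀ z' ∈ A, z ≠ z' → Disjoint (P z \ P a) (P z' \ P a))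
    (hbA : b ∈ A) (hba : b ∉ P a) (hbb : b ∈ P b) (hs : s ∈ P a) (hsm : (P s).card = m + 1)
    (hP'b : P' b = insert b ((P a).filter fun y => (P y).card ≤ m))
    (hP'1 : ∀ x, x ≠ b → s ∈ P x → P' x = insert b (P x)) (hP'2 : ∀ x, x ≠ b → s ∉ P x → P' x = P x)
    (hq' : ∀ i, i ≠ b → i ≠ s → q' i = q i) (hq'sb : (q' s : ℝ) * q' b = q s)
    (hq'b : (q' b : ℝ) * ∏ y ∈ (P a).filter (fun y => (P y).card ≤ m), (q y : ℝ) = ∏ y ∈ P b, (q y : ℝ)) :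
    (∏ y ∈ P' a, (q' y : ℝ)) = ∏ y ∈ P a, (q y : ℝ) ∧ ∀ z ∈ A, (∏ y ∈ P' z, (q' y : ℝ)) = ∏ y ∈ P z, (q y : ℝ) := by
  have hPa : P' a = insert b (P a) := comb_splice_spine_eq P P' a hba hbb hs hP'1
  obtain ⟨-, hsSm, hbSm⟩ := comb_splice_Sm_facts P a hsp hba hs hsm (b := b)
  have hbz : ∀ {z : ι}, z ∈ A → z ≠ b → b ∉ P z := by
    intro z hz hzb h
    exact Finset.disjoint_left.1 (hA6 z hz b hbA hzb) (Finset.mem_sdiff.2 ⟨h, hba⟩) (Finset.mem_sdiff.2 ⟨hbb, hba⟩)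
  have hsb : s ≠ b := fun h => hba (h ▸ hs)
  -- a prefix containing `s` but not `b`: replace `q s` by `q' s · q' b`
  have hdeep : ∀ F : Finset ι, s ∈ F → b ∉ F → (∏ y ∈ insert b F, (q' y : ℝ)) = ∏ y ∈ F, (q y : ℝ) := by
    intro F hsF hbF
    rw [Finset.prod_insert hbF, ← Finset.mul_prod_erase F _ hsF, ← Finset.mul_prod_erase F (fun y => (q y : ℝ)) hsF,
      ← mul_assoc, mul_comm ((q' b : ℝ)), hq'sb]
    congr 1
    exact Finset.prod_congr rfl fun y hy => by rw [hq' y (fun h => hbF (h ▸ Finset.mem_of_mem_erase hy)) (Finset.ne_of_mem_erase hy)]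
  -- a prefix containing neither
  have hshal : ∀ F : Finset ι, s ∉ F → b ∉ F → (∏ y ∈ F, (q' y : ℝ)) = ∏ y ∈ F, (q y : ℝ) := fun F hsF hbF =>
    Finset.prod_congr rfl fun y hy => by rw [hq' y (fun h => hbF (h ▸ hy)) (fun h => hsF (h ▸ hy))]
  refine ⟨by rw [hPa]; exact hdeep (P a) hs hba, fun z hz => ?_⟩
  by_cases hzb : z = b
  · subst hzb
    rw [hP'b, Finset.prod_insert hbSm, hshal _ hsSm hbSm, hq'b]
  · by_cases hsz : s ∈ P z
    · rw [hP'1 z hzb hsz]; exact hdeep (P z) hsz (hbz hz hzb)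
    · rw [hP'2 z hzb hsz]; exact hshal (P z) hsz (hbz hz hzb)

/-- **The spliced hair is no longer a hair**: the set of relays attached off the spine at a positive level loses exactly `b`. [this work] -/
theorem comb_splice_measure (P P' : ι → Finset ι) (a : ι) (A : Finset ι) {b s : ι} {m : ℕ}
    (hA6 : ∀ z ∈ A, ∀ z' ∈ A, z ≠ z' → Disjoint (P z \ P a) (P z' \ P a))
    (hbA : b ∈ A) (hba : b ∉ P a) (hbb : b ∈ P b) (hs : s ∈ P a)
    (hP'b : P' b = insert b ((P a).filter fun y => (P y).card ≤ m))
    (hP'1 : ∀ x, x ≠ b → s ∈ P x → P' x = insert b (P x)) (hP'2 : ∀ x, x ≠ b → s ∉ P x → P' x = P x) :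
    A.filter (fun z => ¬ P' z ⊆ P' a ∧ (P' z ∩ P' a).Nonempty) =
      (A.filter fun z => ¬ P z ⊆ P a ∧ (P z ∩ P a).Nonempty).erase b := by
  have hPa : P' a = insert b (P a) := comb_splice_spine_eq P P' a hba hbb hs hP'1
  have hbz : ∀ {z : ι}, z ∈ A → z ≠ b → b ∉ P z := by
    intro z hz hzb h
    exact Finset.disjoint_left.1 (hA6 z hz b hbA hzb) (Finset.mem_sdiff.2 ⟨h, hba⟩) (Finset.mem_sdiff.2 ⟨hbb, hba⟩)
  ext z
  rw [Finset.mem_erase, Finset.mem_filter, Finset.mem_filter, hPa]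
  constructor
  · rintro ⟨hz, h1, h2⟩
    have hzb : z ≠ b := by
      rintro rfl
      exact h1 (by rw [hP'b]; exact Finset.insert_subset_insert _ (Finset.filter_subset _ _))
    refine ⟨hzb, hz, ?_, ?_⟩
    · intro hsub
      by_cases hsz : s ∈ P z
      · rw [hP'1 z hzb hsz] at h1; exact h1 (Finset.insert_subset_insert _ hsub)
      · rw [hP'2 z hzb hsz] at h1; exact h1 (hsub.trans (Finset.subset_insert _ _))
    · by_cases hsz : s ∈ P z
      · exact ⟨s, Finset.mem_inter.2 ⟨hsz, hs⟩⟩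
      · rw [hP'2 z hzb hsz] at h2
        obtain ⟨y, hy⟩ := h2
        rw [Finset.mem_inter, Finset.mem_insert] at hy
        rcases hy.2 with h | h
        · exact absurd (h ▸ hy.1) (hbz hz hzb)
        · exact ⟨y, Finset.mem_inter.2 ⟨hy.1, h⟩⟩
  · rintro ⟨hzb, hz, h1, h2⟩
    refine ⟨hz, ?_, ?_⟩
    · intro hsub
      by_cases hsz : s ∈ P z
      · rw [hP'1 z hzb hsz] at hsub
        apply h1
        intro y hy
        have := hsub (Finset.mem_insert_of_mem hy)
        rw [Finset.mem_insert] at this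
        rcases this with h | h
        · exact absurd (h ▸ hy) (hbz hz hzb)
        · exact h
      · rw [hP'2 z hzb hsz] at hsub
        apply h1
        intro y hy
        have := hsub hy
        rw [Finset.mem_insert] at this
        rcases this with h | h
        · exact absurd (h ▸ hy) (hbz hz hzb)
        · exact h
    · obtain ⟨y, hy⟩ := h2
      rw [Finset.mem_inter] at hy
      refine ⟨y, Finset.mem_inter.2 ⟨?_, Finset.mem_insert_of_mem hy.2⟩⟩
      by_cases hsz : s ∈ P z
      · rw [hP'1 z hzb hsz]; exact Finset.mem_insert_of_mem hy.1
      · rw [hP'2 z hzb hsz]; exact hy.1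

end Quant

end Summit.CriticalPhenomena.PercolationContinuityZ3.Theorems

end
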